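import Summits.Ventures.QEC.Census.CertCheckBZ
import HarnessLib

/-!
# The `bz` block check split into its parts: information-set facts (KERNEL) · enumeration (any tier) · bound
# (plan/PARTITION.md v2.6 item S7.BZI; CERT-REQS v1.4 C17 (5)–(7))

`Census/CertCheckBZ.lean` (type-10) checks one Brouwer–Zimmermann block monolithically:
`bzBlockOK = (∀ matrices, systematicOK ∧ word sizes ∧ scan-replay) ∧ bound`. For `[[144,12,12]]` the scan-replay of
one block is `3 · 10⁷` codewords (native ≈ 200 s, kernel out of reach — qec-search-7 S1.BZS 2026-08-26), while the
information-set facts (each `G_i = A_i · G_b` SYSTEMATIC on `T_i`, rows `< 2^n`) and the relative-rank bound are tiny.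
This file names the three parts as separate Bool words per (side, block, matrix) and proves that together they give
the block check, so that an emitted certificate can keep the structure KERNEL-checked (`decide +kernel`) and confine
`native_decide` to the enumeration verdicts:

* `DistCert.bzZSys c z b i` / `bzXSys` — matrix `i` of block `b` is systematic on its information set and its rows
  are words `< 2^n` (C3; the `hsys`/`hG` inputs of `BZAssembly.forall_lt_of_bz`);
* `DistCert.bzZEnum c z b i` / `bzXEnum` — the enumeration verdict of matrix `i` of block `b` (C4);
* `DistCert.bzZBound c z b` / `bzXBound` — the recounted relative-rank bound of block `b` reaches `wEff + 1` (C3);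
* `DistCert.bzZBlock_of_parts` / `bzXBlock_of_parts` — parts ⇒ `bzZBlock c z b = true`.

Pure definitions unfolding to type-10's words; axioms ⊆ {propext, Classical.choice, Quot.sound}.
-/

namespace Summit.Ventures.QEC.Census

open Literature.InformationTheory.QuantumCodes

/-- Systematic-form + word-size part of `matrixOK` for one matrix of a block with block matrix rows `Gb`. -/
def matrixSysOK (n : ℕ) (Gb : List ℕ) (mt : BZMatrix) : Bool :=
  systematicOK n (giRows Gb mt) mt.T && ((giRows Gb mt).all fun g => decide (g < 2 ^ n))

/-- Enumeration part of `matrixOK`: the `scan` of budget `t` over the rows of `G_i` with leaf `bzLeaf`. -/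
def matrixEnumOK (wmax : ℕ) (allow Gb : List ℕ) (mt : BZMatrix) : Bool :=
  scan (bzLeaf wmax allow) (rowPos (giRows Gb mt) 0) mt.t 0 0

/-- `matrixOK` is the conjunction of its two parts. -/
theorem matrixOK_eq (n wmax : ℕ) (allow Gb : List ℕ) (mt : BZMatrix) :
    matrixOK n wmax allow Gb mt = (matrixSysOK n Gb mt && matrixEnumOK wmax allow Gb mt) := by
  simp only [matrixOK, matrixSysOK, matrixEnumOK, Bool.and_assoc]

namespace DistCert

variable (c : DistCert) (z : BZData)

/-- `Z` side, block `b`, matrix `i`: information-set facts (systematic on `T_i`, rows `< 2^n`); `true` past the end. -/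
def bzZSys (b i : ℕ) : Bool :=
  match z.sideZ.blocks[b]? with
  | none => true
  | some blk =>
    match blk.mats[i]? with
    | none => true
    | some mt => matrixSysOK c.n (gbRows c.HZ z.rcZ z.LZ blk) mt

/-- `Z` side, block `b`, matrix `i`: the enumeration verdict; `true` past the end. -/
def bzZEnum (b i : ℕ) : Bool :=
  match z.sideZ.blocks[b]? with
  | none => true
  | some blk =>
    match blk.mats[i]? with
    | none => true
    | some mt => matrixEnumOK (c.dZ - 1) (c.sideZ.found.map Prod.fst) (gbRows c.HZ z.rcZ z.LZ blk) mt

/-- `Z` side, block `b`: the relative-rank bound reaches `wEff + 1`; `true` past the end. -/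
def bzZBound (b : ℕ) : Bool :=
  match z.sideZ.blocks[b]? with
  | none => true
  | some blk =>
    decide (wEff (c.dZ - 1) z.sideZ.evenWitness + 1 ≤ bzBoundList c.n (gbRows c.HZ z.rcZ z.LZ blk).length blk.mats 0)

/-- `X` side, block `b`, matrix `i`: information-set facts. -/
def bzXSys (b i : ℕ) : Bool :=
  match z.sideX.blocks[b]? with
  | none => true
  | some blk =>
    match blk.mats[i]? with
    | none => true
    | some mt => matrixSysOK c.n (gbRows c.HX z.rcX z.LX blk) mt

/-- `X` side, block `b`, matrix `i`: the enumeration verdict. -/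
def bzXEnum (b i : ℕ) : Bool :=
  match z.sideX.blocks[b]? with
  | none => true
  | some blk =>
    match blk.mats[i]? with
    | none => true
    | some mt => matrixEnumOK (c.dX - 1) (c.sideX.found.map Prod.fst) (gbRows c.HX z.rcX z.LX blk) mt

/-- `X` side, block `b`: the relative-rank bound. -/
def bzXBound (b : ℕ) : Bool :=
  match z.sideX.blocks[b]? with
  | none => true
  | some blk =>
    decide (wEff (c.dX - 1) z.sideX.evenWitness + 1 ≤ bzBoundList c.n (gbRows c.HX z.rcX z.LX blk).length blk.mats 0)

/-- A list `all` from pointwise facts indexed below the length. -/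
private theorem all_eq_true_of_forall {α : Type*} (l : List α) (p : α → Bool)
    (h : ∀ i : ℕ, (hi : i < l.length) → p l[i] = true) : l.all p = true := by
  rw [List.all_eq_true]
  intro x hx
  obtain ⟨i, hi, rfl⟩ := List.getElem_of_mem hx
  exact h i hi

/-- **Parts ⇒ block, `Z` side**: if block `b` exists with `m` matrices, the `m` information-set facts, the `m`
enumeration verdicts and the bound give `bzZBlock c z b = true`. -/
theorem bzZBlock_of_parts {b m : ℕ} {blk : BZBlock} (hb : z.sideZ.blocks[b]? = some blk) (hm : blk.mats.length = m)
    (hs : ∀ i, i < m → c.bzZSys z b i = true) (he : ∀ i, i < m → c.bzZEnum z b i = true)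
    (hbd : c.bzZBound z b = true) : c.bzZBlock z b = true := by
  simp only [bzZBlock, bzBlockOK, hb, blockOK, Bool.and_eq_true]
  simp only [bzZBound, hb] at hbd
  refine ⟨all_eq_true_of_forall _ _ fun i hi => ?_, hbd⟩
  have h1 := hs i (hm ▸ hi)
  have h2 := he i (hm ▸ hi)
  simp only [bzZSys, bzZEnum, hb, List.getElem?_eq_getElem hi] at h1 h2
  rw [matrixOK_eq, h1, h2, Bool.and_self]

/-- **Parts ⇒ block, `X` side**. -/
theorem bzXBlock_of_parts {b m : ℕ} {blk : BZBlock} (hb : z.sideX.blocks[b]? = some blk) (hm : blk.mats.length = m)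
    (hs : ∀ i, i < m → c.bzXSys z b i = true) (he : ∀ i, i < m → c.bzXEnum z b i = true)
    (hbd : c.bzXBound z b = true) : c.bzXBlock z b = true := by
  simp only [bzXBlock, bzBlockOK, hb, blockOK, Bool.and_eq_true]
  simp only [bzXBound, hb] at hbd
  refine ⟨all_eq_true_of_forall _ _ fun i hi => ?_, hbd⟩
  have h1 := hs i (hm ▸ hi)
  have h2 := he i (hm ▸ hi)
  simp only [bzXSys, bzXEnum, hb, List.getElem?_eq_getElem hi] at h1 h2
  rw [matrixOK_eq, h1, h2, Bool.and_self]

end DistCert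

end Summit.Ventures.QEC.Census
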